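/- Copyright: the b2b-balaban cell (near-miss cell 7), T⁴-continuum fan-out, lineage t4-ne7b-p1 (node U5c COUNT
member).  Released under the licence of the surrounding project. -/
import Summits.QuantumFields.BalabanUV.T4Continuum.Support.HistoryGenealogyRealise
import Summits.QuantumFields.BalabanUV.T4Continuum.Support.HistoryRealisePrint

/-!
# Genealogy REALISATION, PRINT-EXACT TWIN (H3-(ID), geometric half M3b-1 over the repair core R-40-a): the join-chain
lemma and the realisation theorem of row S14 re-proved for `HistoryRealisePrint.RealisesP`, with the join∕pendency
clause in print's STRICTLY-BEFORE form (owner module of row NE7b, lineage `t4-ne7b-p1` gen 40, rulings R-OWNER-40-1∕-2;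
located MODEL finding F-ne7bp1g40-1; `SCOPE-alpha.md` v2.1 §5: the junction M4 is typed over `RealisesP` —
PRE-POSITIONING ONLY)

Summits-side support leaf of the T⁴-continuum cell (rung (B)+1 on a FINITE torus only; NOT infinite volume, NOT the
mass gap, NOT the Clay statement; NOT a proof of the spine estimate NE7b, which is the cell's OWN estimate, NOT PRINTED
and NOT PROVED).  [folklore] finite combinatorics in the ℤᵈ index model over row S14 (`HistoryGenealogyRealiseChain`
p245953, `HistoryGenealogyRealise` p246037: `ChainTouch`, `img`, `unionL`, `imgC`, `edom`, `cpairS`, `cpair0`,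
`orbit_level_succ`) and the print-exact core `HistoryRealisePrint` (`RealisesP`, `PendingBefore`); nothing printed is
asserted, no `def … : Prop` fact of Bałaban's, no cite-tagged hypothesis, zero `sorry`.  B16 = [Balaban1989LargeFieldII]
pp. 381–387 and B15 = [Balaban1989LargeFieldI] p. 177 are manuscripts UNDER AUDIT; locators only (C-B16-6).

WHY.  Row S14's `realises_pgen` concludes row S1b's `Realises`, whose join clause asks the partners to be pending
THROUGH the join scale; print's construction guarantees pendency only STRICTLY BEFORE it (F-ne7bp1g40-1: 𝐑^{(n)} acts on
readiness at scale n at the start of step n+1, so an un-renewed component of `Z_j` merged at `j+1` is unready at scales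
`≤ j` and nothing is asked at `j+1`).  The junction M4 must therefore be typed over the print-exact `RealisesP`; this twin
supplies the realisation theorem in that currency, with the displayed clause (G-pend) weakened to
`PendingBefore … (j+1)` — the form M3b-2 can discharge from the aliveness rule «alive at level j ⇒ not ready at scales
≤ j» — every other clause verbatim.  BY-NAME EFFECT ON THE WALL: NONE (pre-positioning for (α) + R-40-a).

WHAT IS DEFINED AND PROVED.  §1 `pendingBefore_self`; **`realisesP_joinTail`**, **`realisesP_assemble_of_two_le`** (join
chains realised in the print-exact sense: partners `PendingBefore … sj`).  §2 **`structure LevelClausesP H dom L s R :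
Prop`** (= `LevelClauses` with (G-pend) := `PendingBefore`), **`levelClausesP_of_levelClauses`**.  §3
`realisesP_birth_of_new_ok`, **`realisesP_pgen`** (under `WF` + `LevelClausesP`: ∀ c ∈ comp j,
`RealisesP L s R (H.pgen j c) (edom H dom j c)` ∧ `dom j c = orbit L s (H.pgen j c).lastStep (edom H dom j c) (j − lastStep)`),
`realisesP_of_mem_comp`, `dom_eq_orbitP`, `disjoint_orbit_of_disjoint_domP`, `adm_of_mem_compP`.

HONEST.  Proves nothing of Bałaban's; the clauses are OUR reading, displayed; NE7b NOT proved; spine 0∕9.  HONEST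
DEPENDENCY (cell): continuum YM on T⁴ ⇐ BetaPertH ∧ nine spine estimates (0/9 proved); BetaPertH ⇐ (D1) ∧ (D4) ∧
CAP+tail; G-an2-4 gates asym, D1 and NE2/3/4.  This file changes none of it. -/

open Finset
open Literature.MathematicalPhysics.QuantumFieldTheory.Balaban1983to89
open Literature.MathematicalPhysics.QuantumFieldTheory.Balaban1983to89.B13ScaleTransfer
open Literature.MathematicalPhysics.QuantumFieldTheory.Balaban1983to89.TreeLength
open Literature.MathematicalPhysics.QuantumFieldTheory.Balaban1983to89.B16SProfile
open Literature.MathematicalPhysics.QuantumFieldTheory.Balaban1983to89.B16MergeGeometry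
open Summit.QuantumFields.BalabanUV.T4Continuum.HistoryAdmissible
open Summit.QuantumFields.BalabanUV.T4Continuum.HistoryAdmissible.PGen
open Summit.QuantumFields.BalabanUV.T4Continuum.HistoryRealise
open Summit.QuantumFields.BalabanUV.T4Continuum.HistoryRealisePrint
open Summit.QuantumFields.BalabanUV.T4Continuum.HistoryGenealogyExtraction

namespace Summit.QuantumFields.BalabanUV.T4Continuum.HistoryGenealogyRealise

noncomputable section

variable {d : ℕ}

/-! ## §1 Join chains realised, print-exact pendency -/

/-- a line is pending strictly before its own last step (vacuously) [folklore] -/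
theorem pendingBefore_self (L : ℕ) (s R : ℕ → ℕ) (t : ℕ) (Z : Finset (Pt d)) : PendingBefore L s R t Z t :=
  ⟨le_rfl, fun k hk _ => by omega⟩

section JoinChain

variable {L : ℕ} {s R : ℕ → ℕ}

/-- **JOIN CHAINS REALISED, PRINT-EXACT PENDENCY.**  Head `T` realised by `ZT` and further constituents `Us` (each realised by its listed
domain), all with `lastStep ≤ sj` and pending STRICTLY BEFORE `sj`, listed so that each image touches the union of the later images,
and a domain `Z` inside the union of all images ⟹ `Realises (joinTail T (Us.map Prod.fst) sj) Z`. [folklore] -/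
theorem realisesP_joinTail (sj : ℕ) :
    ∀ (T : PGen (Lab d)) (ZT : Finset (Pt d)) (Us : List (PGen (Lab d) × Finset (Pt d))), Us ≠ [] →
      RealisesP L s R T ZT → T.lastStep ≤ sj → PendingBefore L s R T.lastStep ZT sj →
      (∀ UZ ∈ Us, RealisesP L s R UZ.1 UZ.2 ∧ UZ.1.lastStep ≤ sj ∧ PendingBefore L s R UZ.1.lastStep UZ.2 sj) →
      ChainTouch (img L s sj (T, ZT) :: Us.map (img L s sj)) →
      ∀ Z, Z ⊆ unionL (img L s sj (T, ZT) :: Us.map (img L s sj)) →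
        RealisesP L s R (joinTail T (Us.map Prod.fst) sj) Z
  | _, _, [], hne, _, _, _, _, _, _, _ => (hne rfl).elim
  | T, ZT, [UZ], _, hT, hTs, hTp, hall, hct, Z, hZ => by
      obtain ⟨hU, hUs, hUp⟩ := hall UZ (by simp)
      have hct' : ChainTouch [img L s sj (T, ZT), img L s sj UZ] := by
        simpa only [List.map_cons, List.map_nil] using hct
      obtain ⟨⟨a, ha, c, hc, hac⟩, -⟩ := (chainTouch_cons_cons _ _ _).1 hct'
      have hc' : c ∈ img L s sj UZ := by simpa using hc
      have hZ' : Z ⊆ img L s sj (T, ZT) ∪ img L s sj UZ := by simpa using hZ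
      show RealisesP L s R (PGen.join T UZ.1 sj) Z
      exact ⟨ZT, UZ.2, hT, hU, hTs, hUs, hTp, hUp, ⟨a, ha, c, hc', hac⟩, hZ'⟩
  | T, ZT, UZ :: VZ :: Us, _, hT, hTs, hTp, hall, hct, Z, hZ => by
      obtain ⟨hU, hUs, hUp⟩ := hall UZ (by simp)
      have hct' : ChainTouch (img L s sj (T, ZT) :: img L s sj UZ :: (VZ :: Us).map (img L s sj)) := by
        simpa using hct
      obtain ⟨⟨a, ha, c, hc, hac⟩, hrest⟩ := (chainTouch_cons_cons _ _ _).1 hct'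
      -- the rest of the chain, realised by the union of its images
      set ZJ : Finset (Pt d) := unionL (img L s sj UZ :: (VZ :: Us).map (img L s sj)) with hZJ
      have hJ : RealisesP L s R (joinTail UZ.1 ((VZ :: Us).map Prod.fst) sj) ZJ :=
        realisesP_joinTail sj UZ.1 UZ.2 (VZ :: Us) (by simp) hU hUs hUp
          (fun W hW => hall W (by simp only [List.mem_cons] at hW ⊢; exact Or.inr hW)) (by simpa using hrest)
          ZJ subset_rfl
      have hlast : (joinTail UZ.1 ((VZ :: Us).map Prod.fst) sj).lastStep = sj := by
        simp [lastStep]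
      show RealisesP L s R (PGen.join T (joinTail UZ.1 (VZ.1 :: Us.map Prod.fst) sj) sj) Z
      have hmap : (VZ :: Us).map Prod.fst = VZ.1 :: Us.map Prod.fst := rfl
      rw [← hmap]
      refine ⟨ZT, ZJ, hT, hJ, hTs, hlast.le, hTp, ?_, ⟨a, ha, c, ?_, hac⟩, ?_⟩
      · rw [hlast]; exact pendingBefore_self L s R sj ZJ
      · rw [hlast, Nat.sub_self, orbit_zero]
        simpa [hZJ] using hc
      · rw [hlast, Nat.sub_self, orbit_zero]
        intro x hx
        have hx' := hZ hx
        simp only [unionL_cons, List.map_cons, Finset.mem_union] at hx' ⊢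
        simpa [img, hZJ, or_assoc] using hx'

/-- **PRINT'S TRICHOTOMY, JOIN BRANCH, REALISED (print-exact pendency)**: for at least two constituents (listed with their domains), the
assembled genealogy at step `sj` is the join chain, realised by any domain inside the union of the images, and its
last step is `sj`. [folklore] -/
theorem realisesP_assemble_of_two_le (c : Lab d) (sj h : ℕ) (r : Bool) (Ps : List (PGen (Lab d) × Finset (Pt d)))
    (h2 : 2 ≤ Ps.length)
    (hall : ∀ UZ ∈ Ps, RealisesP L s R UZ.1 UZ.2 ∧ UZ.1.lastStep ≤ sj ∧ PendingBefore L s R UZ.1.lastStep UZ.2 sj)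
    (hct : ChainTouch (Ps.map (img L s sj))) {Z : Finset (Pt d)} (hZ : Z ⊆ unionL (Ps.map (img L s sj))) :
    RealisesP L s R (assemble c sj h (Ps.map Prod.fst) r) Z ∧ (assemble c sj h (Ps.map Prod.fst) r).lastStep = sj := by
  match Ps, h2, hall, hct, hZ with
  | [], h2, _, _, _ => simp at h2
  | [_], h2, _, _, _ => simp at h2
  | TZ :: UZ :: Us, _, hall, hct, hZ =>
      obtain ⟨hT, hTs, hTp⟩ := hall TZ (by simp)
      simp only [List.map_cons, assemble_cons_cons]
      refine ⟨?_, rfl⟩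
      have hmap : UZ.1 :: Us.map Prod.fst = (UZ :: Us).map Prod.fst := rfl
      rw [hmap]
      exact realisesP_joinTail sj TZ.1 TZ.2 (UZ :: Us) (by simp) hT hTs hTp
        (fun W hW => hall W (by simp only [List.mem_cons] at hW ⊢; exact Or.inr hW)) (by simpa using hct) Z
        (by simpa using hZ)

end JoinChain

/-! ## §2 The displayed clauses with print-exact pendency -/

namespace GeomHistory

variable (H : ComponentHistory (Lab d)) (dom : ℕ → Lab d → Finset (Pt d)) (L : ℕ) (s R : ℕ → ℕ)

/-- **THE DISPLAYED PER-LEVEL GEOMETRIC CLAUSES, PRINT-EXACT PENDENCY** — `LevelClauses` of row S14 with (G-pend)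
weakened to what print's construction guarantees: every old part of a JOINED component of level `j + 1` is pending
STRICTLY BEFORE `j + 1` (alive at level `j` ⇒ not ready at the scales `≤ j`; nothing asked at the join scale). All other
clauses verbatim (hypothesis SHAPE, never asserted; locators B16 pp. 381–387). [folklore] -/
structure LevelClausesP : Prop where
  /-- (G-new) new regions: anchored, face-connected, class at least the tree length -/
  new_ok : ∀ j, ∀ n ∈ H.newReg j, n.1 ∈ n.2 ∧ FaceConnected n.2 ∧ treeLen n.2 ≤ H.cls n
  /-- (G-birth) a lone new region is its component's domain -/
  dom_birth : ∀ j c n, c ∈ H.comp j → H.constit j c = [Sum.inr n] → dom j c = n.2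
  /-- (G-flow) a component continued alone flows by one S-operation -/
  dom_flow : ∀ j c p, c ∈ H.comp (j + 1) → H.constit (j + 1) c = [Sum.inl p] →
    dom (j + 1) c = Sop (ratio L s j) (dom j p)
  /-- (G-ready) renewal at the first readiness of the continued line -/
  ready : ∀ j c p, c ∈ H.comp (j + 1) → H.constit (j + 1) c = [Sum.inl p] → H.fieldIn (j + 1) c = true →
    Stops L s R (H.pgen j p).lastStep (edom H dom j p) (j - (H.pgen j p).lastStep) ∧
      ∀ k, k < j - (H.pgen j p).lastStep → ¬ Stops L s R (H.pgen j p).lastStep (edom H dom j p) k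
  /-- (G-pend, print-exact) the old parts of a joined component are pending strictly before the join step -/
  pend : ∀ j c, c ∈ H.comp (j + 1) → 2 ≤ (H.constit (j + 1) c).length → ∀ p ∈ H.parts (j + 1) c,
    PendingBefore L s R (H.pgen j p).lastStep (edom H dom j p) (j + 1)
  /-- (G-touch) leaf-first order: each image touches the union of the later images -/
  touch : ∀ j c, c ∈ H.comp j → 2 ≤ (H.constit j c).length → ChainTouch ((H.constit j c).map (imgC L s dom j))
  /-- (G-join) the joined domain lies inside the union of the images -/
  dom_join : ∀ j c, c ∈ H.comp j → 2 ≤ (H.constit j c).length → dom j c ⊆ unionL ((H.constit j c).map (imgC L s dom j))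

variable {H dom L s R}

/-- the clauses of row S14 imply the print-exact ones [folklore] -/
theorem levelClausesP_of_levelClauses (hG : LevelClauses H dom L s R) : LevelClausesP H dom L s R where
  new_ok := hG.new_ok
  dom_birth := hG.dom_birth
  dom_flow := hG.dom_flow
  ready := hG.ready
  pend j c hc h2 p hp := pendingBefore_of_pendingAt (hG.pend j c hc h2 p hp)
  touch := hG.touch
  dom_join := hG.dom_join

end GeomHistory

/-! ## §3 The realisation theorem, print-exact form -/

section Main

open GeomHistory ComponentHistory

variable {L : ℕ} {s R : ℕ → ℕ} {H : ComponentHistory (Lab d)} {dom : ℕ → Lab d → Finset (Pt d)}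

/-- a new region, under (G-new), is realised by itself as a birth at any step [folklore] -/
theorem realisesP_birth_of_new_ok {n : Lab d} (hn : n.1 ∈ n.2 ∧ FaceConnected n.2 ∧ treeLen n.2 ≤ H.cls n) (j : ℕ) :
    RealisesP L s R (PGen.birth j (H.cls n) n) n.2 :=
  ⟨rfl, hn.1, hn.2.1, hn.2.2⟩

/-- **THE REALISATION THEOREM.**  Under `WF` and the displayed per-level clauses, EVERY extracted genealogy is realised
by its last-event domain, and the current domain is the orbit of the last-event domain from the last step:
`RealisesP L s R (H.pgen j c) (edom H dom j c) ∧ dom j c = orbit L s (H.pgen j c).lastStep (edom H dom j c) (j − lastStep)`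
for every `c ∈ comp j` (induction on the level through print's trichotomy: no event — inherited; renewal — (G-flow) +
(G-ready); lone birth — (G-new) + (G-birth); join chain — `realisesP_assemble_of_two_le` with (G-pend), (G-touch),
(G-join), births pending trivially at their own step). [folklore] -/
theorem realisesP_pgen (hW : H.WF) (hG : LevelClausesP H dom L s R) :
    ∀ (j : ℕ) (c : Lab d), c ∈ H.comp j →
      RealisesP L s R (H.pgen j c) (edom H dom j c) ∧
        dom j c = orbit L s (H.pgen j c).lastStep (edom H dom j c) (j - (H.pgen j c).lastStep)
  | 0, c, hc => by
      -- level 0: births only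
      have hl0 : lefts (H.constit 0 c) = [] := hW.parts_zero c
      have hne : H.constit 0 c ≠ [] := hW.nonempty 0 c hc
      -- every constituent is a new region of step 0
      have hmem : ∀ x ∈ H.constit 0 c, ∃ n, x = Sum.inr n ∧ n ∈ H.newReg 0 := by
        intro x hx
        obtain ⟨n, rfl⟩ := exists_inr_of_lefts_eq_nil hl0 x hx
        exact ⟨n, rfl, hW.news_sub 0 c hc n ((mem_rights_iff n _).2 hx)⟩
      have hbirths : H.births 0 c = ((H.constit 0 c).map (cpair0 H dom)).map Prod.fst := by
        rw [List.map_map]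
        unfold ComponentHistory.births ComponentHistory.news
        rw [show Prod.fst ∘ cpair0 H dom = Sum.elim (fun p => H.pgen 0 p) fun n => PGen.birth 0 (H.cls n) n from
          funext fun x => by cases x <;> rfl, map_sum_elim_of_lefts_eq_nil _ _ _ hl0]
      match hcs : H.constit 0 c, hne, hmem with
      | [], hne, _ => exact (hne rfl).elim
      | [x], _, hmem =>
          obtain ⟨n, rfl, hn⟩ := hmem x (by simp)
          have hpg : H.pgen 0 c = PGen.birth 0 (H.cls n) n := H.pgen_zero_birth c n hcs
          have hd : dom 0 c = n.2 := hG.dom_birth 0 c n hc hcs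
          rw [hpg, edom_zero, hd]
          exact ⟨realisesP_birth_of_new_ok (hG.new_ok 0 n hn) 0, by simp [lastStep]⟩
      | x :: y :: l, _, hmem =>
          have h2 : 2 ≤ (H.constit 0 c).length := by rw [hcs]; simp
          -- images of births at their own step are the regions
          have himg : ((H.constit 0 c).map (cpair0 H dom)).map (img L s 0) = (H.constit 0 c).map (imgC L s dom 0) := by
            rw [List.map_map]
            refine List.map_congr_left fun z hz => ?_
            obtain ⟨n, rfl, -⟩ := hmem z (hcs ▸ hz)
            simp [cpair0, img, lastStep]
          have hall : ∀ UZ ∈ (H.constit 0 c).map (cpair0 H dom),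
              RealisesP L s R UZ.1 UZ.2 ∧ UZ.1.lastStep ≤ 0 ∧ PendingBefore L s R UZ.1.lastStep UZ.2 0 := by
            intro UZ hUZ
            obtain ⟨z, hz, rfl⟩ := List.mem_map.1 hUZ
            obtain ⟨n, rfl, hn⟩ := hmem z (hcs ▸ hz)
            exact ⟨realisesP_birth_of_new_ok (hG.new_ok 0 n hn) 0, le_rfl, pendingBefore_self L s R 0 _⟩
          have hct : ChainTouch (((H.constit 0 c).map (cpair0 H dom)).map (img L s 0)) := by
            rw [himg]; exact hG.touch 0 c hc h2
          have hZ : dom 0 c ⊆ unionL (((H.constit 0 c).map (cpair0 H dom)).map (img L s 0)) := by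
            rw [himg]; exact hG.dom_join 0 c hc h2
          have hlen : 2 ≤ ((H.constit 0 c).map (cpair0 H dom)).length := by simpa using h2
          obtain ⟨hR, hlast⟩ := realisesP_assemble_of_two_le (L := L) (s := s) (R := R) c 0 0 false _ hlen hall hct hZ
          rw [pgen_zero_eq_assemble, hbirths, edom_zero]
          exact ⟨hR, by rw [hlast]; simp⟩
  | j + 1, c, hc => by
      have hne : H.constit (j + 1) c ≠ [] := hW.nonempty (j + 1) c hc
      -- the induction hypothesis for the old parts, and their images
      have ih : ∀ p ∈ H.parts (j + 1) c,
          RealisesP L s R (H.pgen j p) (edom H dom j p) ∧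
            dom j p = orbit L s (H.pgen j p).lastStep (edom H dom j p) (j - (H.pgen j p).lastStep) :=
        fun p hp => realisesP_pgen hW hG j p (hW.parts_sub j c hc p hp)
      have himgp : ∀ p ∈ H.parts (j + 1) c,
          img L s (j + 1) (H.pgen j p, edom H dom j p) = Sop (ratio L s j) (dom j p) := by
        intro p hp
        have ht : (H.pgen j p).lastStep ≤ j := H.lastStep_pgen_le j p
        rw [(ih p hp).2, img, orbit_level_succ L s ht]
      match hcs : H.constit (j + 1) c, hne with
      | [], hne => exact (hne rfl).elim
      | [Sum.inl p], _ =>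
          have hp : p ∈ H.parts (j + 1) c := by simp [ComponentHistory.parts, hcs]
          have ht : (H.pgen j p).lastStep ≤ j := H.lastStep_pgen_le j p
          have hflow := hG.dom_flow j c p hc hcs
          cases hf : H.fieldIn (j + 1) c with
          | false =>
              -- NO EVENT: inherited
              rw [H.pgen_succ_noEvent j c p hcs hf, edom_succ_noEvent H dom hcs hf]
              refine ⟨(ih p hp).1, ?_⟩
              rw [hflow, (ih p hp).2, ← orbit_level_succ L s ht]
          | true =>
              -- RENEWAL at the first readiness
              obtain ⟨hstop, hfirst⟩ := hG.ready j c p hc hcs hf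
              have hev : edom H dom (j + 1) c = dom (j + 1) c :=
                edom_succ_event H dom (by rw [hcs, hf]; rfl)
              rw [H.pgen_succ_renew j c p hcs hf, hev]
              refine ⟨⟨edom H dom j p, (ih p hp).1, hstop, hfirst, ?_⟩, by simp [lastStep]⟩
              rw [hflow, (ih p hp).2, ← orbit_level_succ L s ht]
      | [Sum.inr n], _ =>
          -- LONE BIRTH
          have hn : n ∈ H.newReg (j + 1) := hW.news_sub (j + 1) c hc n (by simp [ComponentHistory.news, hcs])
          have hev : edom H dom (j + 1) c = dom (j + 1) c := edom_succ_event H dom (by rw [hcs]; simp)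
          rw [H.pgen_succ_birth j c n hcs, hev, hG.dom_birth (j + 1) c n hc hcs]
          exact ⟨realisesP_birth_of_new_ok (hG.new_ok (j + 1) n hn) (j + 1), by simp [lastStep]⟩
      | x :: y :: l, _ =>
          -- JOIN CHAIN at step j + 1
          have h2 : 2 ≤ (H.constit (j + 1) c).length := by rw [hcs]; simp
          have hev : edom H dom (j + 1) c = dom (j + 1) c := edom_succ_event H dom (by rw [hcs]; simp)
          have himg : ((H.constit (j + 1) c).map (cpairS H dom j)).map (img L s (j + 1)) =
              (H.constit (j + 1) c).map (imgC L s dom (j + 1)) := by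
            rw [List.map_map]
            refine List.map_congr_left fun z hz => ?_
            cases z with
            | inl p =>
                have hp : p ∈ H.parts (j + 1) c := (mem_lefts_iff p _).2 hz
                simpa [cpairS] using himgp p hp
            | inr n => simp [cpairS, img, lastStep]
          have hall : ∀ UZ ∈ (H.constit (j + 1) c).map (cpairS H dom j),
              RealisesP L s R UZ.1 UZ.2 ∧ UZ.1.lastStep ≤ j + 1 ∧ PendingBefore L s R UZ.1.lastStep UZ.2 (j + 1) := by
            intro UZ hUZ
            obtain ⟨z, hz, rfl⟩ := List.mem_map.1 hUZ
            cases z with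
            | inl p =>
                have hp : p ∈ H.parts (j + 1) c := (mem_lefts_iff p _).2 hz
                exact ⟨(ih p hp).1, (H.lastStep_pgen_le j p).trans (Nat.le_succ j), hG.pend j c hc h2 p hp⟩
            | inr n =>
                have hn : n ∈ H.newReg (j + 1) := hW.news_sub (j + 1) c hc n ((mem_rights_iff n _).2 hz)
                exact ⟨realisesP_birth_of_new_ok (hG.new_ok (j + 1) n hn) (j + 1), le_rfl,
                  pendingBefore_self L s R (j + 1) _⟩
          have hct : ChainTouch (((H.constit (j + 1) c).map (cpairS H dom j)).map (img L s (j + 1))) := by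
            rw [himg]; exact hG.touch (j + 1) c hc h2
          have hZ : dom (j + 1) c ⊆ unionL (((H.constit (j + 1) c).map (cpairS H dom j)).map (img L s (j + 1))) := by
            rw [himg]; exact hG.dom_join (j + 1) c hc h2
          have hlen : 2 ≤ ((H.constit (j + 1) c).map (cpairS H dom j)).length := by simpa using h2
          obtain ⟨hR, hlast⟩ := realisesP_assemble_of_two_le (L := L) (s := s) (R := R) c (j + 1) j
            (H.ren (j + 1) c) _ hlen hall hct hZ
          rw [pgen_succ_eq_assemble, constituents_eq_map_cpairS, hev]
          exact ⟨hR, by rw [hlast]; simp⟩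

/-- **EVERY COMPONENT'S GENEALOGY IS REALISED by its last-event domain.** [folklore] -/
theorem realisesP_of_mem_comp (hW : H.WF) (hG : LevelClausesP H dom L s R) {j : ℕ} {c : Lab d} (hc : c ∈ H.comp j) :
    RealisesP L s R (H.pgen j c) (edom H dom j c) :=
  (realisesP_pgen hW hG j c hc).1

/-- **THE CURRENT DOMAIN IS THE ORBIT OF THE LAST-EVENT DOMAIN** (`HistoryRealiseCells.curDomain` by `rfl`). [folklore] -/
theorem dom_eq_orbitP (hW : H.WF) (hG : LevelClausesP H dom L s R) {j : ℕ} {c : Lab d} (hc : c ∈ H.comp j) :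
    dom j c = orbit L s (H.pgen j c).lastStep (edom H dom j c) (j - (H.pgen j c).lastStep) :=
  (realisesP_pgen hW hG j c hc).2

/-- **DISJOINT CURRENT DOMAINS TRANSFER TO THE ORBITS** (the shape of the `disjoint` field of `RealisedDomains`:
distinct live components of one term have disjoint current domains at the cutoff). [folklore] -/
theorem disjoint_orbit_of_disjoint_domP (hW : H.WF) (hG : LevelClausesP H dom L s R) {K : ℕ} {c c' : Lab d}
    (hc : c ∈ H.comp K) (hc' : c' ∈ H.comp K) (hdis : Disjoint (dom K c) (dom K c')) :
    Disjoint (orbit L s (H.pgen K c).lastStep (edom H dom K c) (K - (H.pgen K c).lastStep))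
      (orbit L s (H.pgen K c').lastStep (edom H dom K c') (K - (H.pgen K c').lastStep)) := by
  rwa [← dom_eq_orbitP hW hG hc, ← dom_eq_orbitP hW hG hc']

/-- the realised genealogy of a component obeys print's timing discipline at its level (row S1b's `adm_of_realises`,
agreeing with row S13's `adm_pgen`) [folklore] -/
theorem adm_of_mem_compP (hW : H.WF) (hG : LevelClausesP H dom L s R) {j : ℕ} {c : Lab d} (hc : c ∈ H.comp j) :
    (H.pgen j c).Adm j :=
  adm_of_realisesP _ _ (realisesP_of_mem_comp hW hG hc) (H.lastStep_pgen_le j c)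

end Main

end

end Summit.QuantumFields.BalabanUV.T4Continuum.HistoryGenealogyRealise
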